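import Literature.Computability.Complexity.KannanLanguageAE
import Literature.Computability.Complexity.CircuitInputMap
import Literature.Computability.Complexity.SpaceProofs
import Literature.Computability.Complexity.SpaceOraclesProofs
import Literature.Computability.Complexity.MurrayWilliams2018EasyWitnessResidual
import HarnessLib

/-!
# A diagonal language hard at every circuit-size scale whose slices are polynomial-time
# projections of ONE `PSPACE` language (Murray–Williams 2018, Thm. 2.3 and Claim 1, via Kannan)

Literature / circuit complexity. Murray–Williams 2018 (C. D. Murray, R. R. Williams, *Circuit
lower bounds for nondeterministic quasi-polytime: an easy witness lemma for NP and NQP*, STOC 2018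
= ECCC TR17-188), §3, uses two ingredients about the diagonal language of the Merlin–Arthur protocol
`M₁` of Thm. 3.1:

* Thm. 2.3 ("folklore"): for a circuit-size function `s` there is `L_diag ∈ SPACE[s(n)²]` without
  `s(n)`-size circuits at all but finitely many lengths;
* Claim 1 (ECCC p. 10): "There is an `O(s(n)^{2d₂})`-time reduction `R` such that for all strings
  `y`, `|R(y)| = s(|y|)^{2d₂}` and `y ∈ L_diag ⟺ R(y) ∈ L_PSPACE`" — obtained from
  `L_diag ∈ SPACE[s(n)²]` and the `PSPACE`-completeness of `L_PSPACE`.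

The only use of the space bound is Claim 1: in the protocol, Arthur maps `y` to a `PSPACE`-query of
length `poly(s(|y|))` about a FIXED complete language. This file supplies exactly that, in a form
that needs no space-bounded machine at the super-polynomial scale `s`: the diagonal language is read
off ONE fixed language of `Σ₄ᵖ ⊆ PSPACE` — Kannan's diagonal language `Kannan.lang 0`
(`KannanLanguage.lean`: at length `N`, the least hard truth table of length `N² + 1` against all
circuit descriptions of length `≤ N²`, Kannan 1982, Lemma 1) — at the PADDED input
`pad (N n) y = y 0^{N(n) - n}` with `N(n) = 10 (s(n) + 2)`:

  `KannanScaled.diag N = {y : pad (N |y|) y ∈ Kannan.lang 0}`.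

* `SigmaP_subset_PSPACE`, `PH_subset_PSPACE` (Arora–Barak 2009, §5.2, from the tree's proved
  closures `P ⊆ PSPACE`, `∃ᵖ·PSPACE ⊆ PSPACE`, `co PSPACE = PSPACE`), `Kannan.lang_mem_PSPACE`;
* `KannanScaled.diag`, **`KannanScaled.lt_circuitSize_diag`** — Thm. 2.3's lower bound at EVERY
  length `n` with `n ≤ N(n)`, `(s+1)(8(N(n)+s)+10) ≤ N(n)²` (descriptions of size-`s` circuits fit
  Kannan's budget at length `N(n)`), `N(n)² + 1 ≤ 2^{N(n)}` (a hard table exists) and `N(n)² < 2ⁿ`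
  (every live address has an `n`-bit name): `s < circuitSize (diag N) n`. Proof: a `B₂`-circuit
  of size `≤ s` for the slice on `n` inputs, with its inputs renamed into the first `n` of `N(n)`
  inputs (`Circuit.mapInputs`, same size), has a description of length `≤ N(n)²`, so the least
  hard table `T` at length `N(n)` defeats it on some live input `pad (N n) y'`, `bitsToNat y' ≤ N(n)²`;
  the `n`-bit name `y` of that address pads to the same word, on which the renamed circuit answers
  `[y ∈ diag N] = T[bitsToNat y]` — the very entry it was supposed to miss;
* `KannanScaled.scale s n = 10 (s n + 2)` and **`KannanScaled.eventually_lt_circuitSize_diag`**: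
  for strictly increasing `s` with `n · s(n)² < 2ⁿ` a.e. (the smallness the assembly of Lemma 4.1
  supplies), `s(n) < circuitSize (diag (scale s)) n` for all large `n` — Thm. 2.3 as consumed by
  Thm. 3.1 (`hdiag` of `AlmostAE.eventually_lt_circuitSize_hardLang_or`);
* **`KannanScaled.exists_reduction_of_isHard`** — Claim 1 in `PSPACE`-hardness form: for every
  `PSPACE`-hard `Lstar` there is `g ∈ FP` (with a polynomial output-length bound) such that
  `y ∈ diag N ⟺ g (pad (N |y|) y) ∈ Lstar`; so the reduction of the printed Claim 1 is
  `R(y) = g(y 0^{N(|y|)-|y|})`, of length `poly(s(|y|))`, computable in time `poly(s(|y|))` once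
  `N(|y|)` is known (time-constructibility of `s`, or `O(log s(n))` bits of advice);
* the Thm-3.1/Lemma-4.1 corollaries with THIS diagonal language in Murray–Williams' `L₁`
  (`AlmostAE.hardLang Lstar (KannanScaled.diag (scale s)) s₁ s₂`):
  `h31_of_hardLang_protocol_kannanScaled` (Theorem 3.1 in universal-referee form from a universal
  protocol for this `hardLang`, the analogue of `h31_of_hardLang_protocol` of
  `MurrayWilliams2018EasyWitnessResidual.lean`, whose `Ldiag` is the counting table
  `GreedyHard.diag s`) and
  `MurrayWilliams2018_lemma_4_1_ae_of_hardLang_protocol_kannanScaled_of_umansGenerator`.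

With this choice of `L_diag` the first branch of the protocol `M₁` ("simulate `L_diag` on `y`:
let `z = R(y)` … guess a circuit `C` … output `M^C(1^{s₂(n)-|z|} z)`") asks Merlin's circuit about a
polynomial-time image of the padded input under the Karp reduction of a fixed `PSPACE` language;
what remains of Theorem 3.1's upper bound is Santhanam's checkable complete language (Thm. 2.2) and
the referee itself. Theorems and definitions with bodies only; no named fact is introduced (D-0026).

## References

* C. D. Murray, R. R. Williams, *Circuit lower bounds for nondeterministic quasi-polytime: an easy
  witness lemma for NP and NQP*, STOC 2018 (ECCC TR17-188), Thm. 2.3, §3 (Claim 1, the protocol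
  `M₁`), Thm. 3.1, Lemma 4.1 [MurrayWilliams2018].
* R. Kannan, *Circuit-size lower bounds and non-reducibility to sparse sets*, Inform. Control 55
  (1982) 40–56, Lemma 1 [Kannan1982].
* S. Arora, B. Barak, *Computational Complexity: A Modern Approach*, CUP 2009, §5.2 (`PH ⊆ PSPACE`),
  Thm. 6.21 (counting) [AroraBarakCC2009].
-/

noncomputable section

namespace Literature.Computability.Complexity

open Filter _root_.Computability Polynomial
open scoped Notation

/-! ### `PH ⊆ PSPACE` -/

/-- **`Σₖᵖ ⊆ PSPACE`** for every `k`: `Σ₀ᵖ = P ⊆ PSPACE`, and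
`Σₖ₊₁ᵖ = ∃ᵖ·coΣₖᵖ ⊆ ∃ᵖ·PSPACE ⊆ PSPACE` by the proved closures `P_subset_PSPACE_holds`,
`co_PSPACE_holds`, `polyExists_PSPACE_subset_PSPACE_holds`. [cite: AroraBarakCC2009, §5.2] -/
theorem SigmaP_subset_PSPACE (k : ℕ) : SigmaP k ⊆ PSPACE := by
  induction k with
  | zero => exact P_subset_PSPACE_holds
  | succ k ih =>
    change polyExists (co (sigmaP Classes.P k)) ⊆ PSPACE
    have hco : co (sigmaP Classes.P k) ⊆ PSPACE :=
      (co_mono ih).trans (show co PSPACE = PSPACE from co_PSPACE_holds).subset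
    exact (polyExists_mono hco).trans polyExists_PSPACE_subset_PSPACE_holds

/-- **`PH ⊆ PSPACE`**. [cite: AroraBarakCC2009, §5.2] -/
theorem PH_subset_PSPACE : PH ⊆ PSPACE :=
  Set.iUnion_subset SigmaP_subset_PSPACE

/-- Kannan's diagonal language lies in `PSPACE` (`Σ₄ᵖ ⊆ PSPACE`). [cite: Kannan1982, Lemma 1] -/
theorem Kannan.lang_mem_PSPACE (k : ℕ) : Kannan.lang k ∈ PSPACE :=
  SigmaP_subset_PSPACE 4 (Kannan.lang_mem_SigmaP_four k)

namespace KannanScaled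

open Kannan CircEval

/-! ### The scaled diagonal language -/

/-- **The diagonal language at scale `N`**: `y ∈ diag N` iff the padded word
`pad (N |y|) y = y 0^{N(|y|)-|y|}` lies in Kannan's language `L₀` — i.e. iff the least hard table at
length `N(|y|)` (length `N(|y|)² + 1`, hard against all descriptions of length `≤ N(|y|)²`) has
entry `1` at the address `bitsToNat y` (Murray–Williams' `L_diag`, Thm. 2.3, with Kannan's least
hard table in place of the lexicographically first hard function). [cite: MurrayWilliams2018, Thm. 2.3] -/
def diag (N : ℕ → ℕ) : Language Bool :=
  {y | pad (N y.length) y ∈ Kannan.lang 0}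

/-- Unfolding membership in `diag N` (definitional). [cite: MurrayWilliams2018, Thm. 2.3] -/
theorem mem_diag_iff {N : ℕ → ℕ} {y : List Bool} :
    y ∈ diag N ↔ pad (N y.length) y ∈ Kannan.lang 0 :=
  Iff.rfl

/-- Kannan's budget at exponent `0` is `N²`. [cite: Kannan1982, Lemma 1 (proof)] -/
theorem bound_zero (N : ℕ) : bound 0 N = N ^ 2 := by
  simp [bound]

/-- Evaluating the description of a circuit on `m` inputs at a word of length `m`, with the inputs
read as `getD`. [cite: AroraBarakCC2009, Thm. 6.18] -/
theorem descAccepts_desc_of_length_eq {m : ℕ} (C : Circuit (Fin m)) (hC : C.IsOver B2)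
    (z : List Bool) (hz : z.length = m) :
    descAccepts (desc C) z = C.eval (fun i : Fin m => z.getD (i : ℕ) false) := by
  subst hz
  rw [descAccepts_desc z C hC]
  congr 1
  funext i
  rw [List.getD_eq_getElem?_getD, List.getElem?_eq_getElem i.2, Option.getD_some, List.get_eq_getElem]

/-- Two words of lengths `≤ m` with the same little-endian value pad to the same word of length
`m`. [folklore] -/
theorem pad_eq_pad_of_bitsToNat_eq {m : ℕ} {y y' : List Bool} (hy : y.length ≤ m)
    (hy' : y'.length ≤ m) (h : bitsToNat y = bitsToNat y') : pad m y = pad m y' :=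
  eq_of_bitsToNat_eq (by rw [length_pad hy, length_pad hy']) (by rw [bitsToNat_pad, bitsToNat_pad, h])

/-- The first `n` symbols of `pad m y` are those of `y` when `|y| = n`. [folklore] -/
theorem getD_pad_of_lt {m n : ℕ} {y : List Bool} (hy : y.length = n) {i : ℕ} (hi : i < n) :
    (pad m y).getD i false = y.getD i false := by
  unfold pad
  rw [List.getD_append _ _ _ _ (by omega)]

/-- **Murray–Williams 2018, Thm. 2.3, lower bound, at every good length** (via Kannan's least hard
table). If `n ≤ N(n)`, the descriptions of size-`s` circuits on `N(n)` inputs fit the budget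
(`(s+1)(8(N(n)+s)+10) ≤ N(n)²`), a hard table exists at length `N(n)` (`N(n)² + 1 ≤ 2^{N(n)}`) and
every live address is `n`-bit (`N(n)² < 2ⁿ`), then the slice of `diag N` at length `n` has circuit
complexity `> s` over `B₂`. [cite: MurrayWilliams2018, Thm. 2.3] -/
theorem lt_circuitSize_diag {N : ℕ → ℕ} {s n : ℕ} (hnN : n ≤ N n)
    (hA : (s + 1) * (8 * (N n + s) + 10) ≤ N n ^ 2) (hB : N n ^ 2 + 1 ≤ 2 ^ N n)
    (hC : N n ^ 2 < 2 ^ n) : s < (diag N).circuitSize n := by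
  by_contra hle
  rw [not_lt] at hle
  obtain ⟨C', hCB, hCf, hCs⟩ := exists_circuit_size_eq_circuitSize (diag N) n
  -- the circuit on `N n` inputs reading the first `n` of them
  set C : Circuit (Fin (N n)) := C'.mapInputs (Fin.castLE hnN) with hCdef
  have hCB' : C.IsOver B2 := hCB.mapInputs _
  have hsize : C.size ≤ s := by rw [hCdef, Circuit.size_mapInputs, hCs]; exact hle
  obtain ⟨T, hT⟩ := exists_isMinHard (exists_isHard 0 (N n) (by rw [bound_zero]; exact hB))
  have hD : (desc C).length ≤ bound 0 (N n) :=
    (length_desc_le_of_size_le C hsize).trans (by rw [bound_zero]; exact hA)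
  obtain ⟨y, hy, hyv, hne⟩ := hT.1.2 (desc C) hD
  apply hne
  -- the `n`-bit name of the live address
  have hv : bitsToNat y < 2 ^ n := lt_of_le_of_lt hyv (by rw [bound_zero]; exact hC)
  set y' : List Bool := bitsOf n (bitsToNat y) with hy'def
  have hy'v : bitsToNat y' = bitsToNat y := bitsToNat_bitsOf n _ hv
  have hy'len : y'.length = n := length_bitsOf n _
  have hpad : pad (N n) y = pad (N n) y' :=
    pad_eq_pad_of_bitsToNat_eq hy (by omega) hy'v.symm
  have hlen : (pad (N n) y').length = N n := length_pad (by omega)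
  -- the renamed circuit on the padded word computes the slice of `diag N` at `y'`
  have hev : descAccepts (desc C) (pad (N n) y') = (diag N).boolIndicator y' := by
    rw [descAccepts_desc_of_length_eq C hCB' _ hlen, hCdef, Circuit.eval_mapInputs]
    have harg : (fun i : Fin n => (pad (N n) y').getD ((Fin.castLE hnN i : Fin (N n)) : ℕ) false) =
        fun i : Fin n => y'.getD (i : ℕ) false := by
      funext i
      exact getD_pad_of_lt hy'len i.2
    rw [harg, hCf]
    change (diag N).boolIndicator (List.ofFn fun i : Fin n => y'.getD (i : ℕ) false) = _
    rw [ofFn_getD_eq_takeD, List.takeD_eq_take, List.take_of_length_le hy'len.le]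
    rw [hy'len]
  -- membership of `y'` is the table entry at its address
  have hiff : y' ∈ diag N ↔ T.getD (bitsToNat y) false = true := by
    rw [mem_diag_iff, hy'len, Kannan.mem_lang_iff (T := T) (by rw [hlen]; exact hT), bitsToNat_pad,
      hy'v]
  rw [hpad, hev]
  by_cases hb : T.getD (bitsToNat y) false = true
  · rw [hb]
    exact (Set.mem_iff_boolIndicator _ _).1 (hiff.2 hb)
  · have hb' : T.getD (bitsToNat y) false = false := by
      simpa using hb
    rw [hb']
    exact (Set.notMem_iff_boolIndicator _ _).1 fun h => hb (hiff.1 h)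

/-! ### The scale `N(n) = 10 (s(n) + 2)` and the eventual form -/

/-- **The scale** `N(n) := 10 · (s(n) + 2)` at which the slice of length `n` is read: large enough
for the descriptions of size-`s(n)` circuits on `N(n)` inputs (`(s+1)(8(N+s)+10) ≤ 88 s² + 258 s +
170 ≤ N²`), and `O(s(n))`, so that a `PSPACE`-query about `pad (N n) y` has length `poly(s(n))`.
[cite: MurrayWilliams2018, Thm. 2.3 (proof)] -/
def scale (s : ℕ → ℕ) (n : ℕ) : ℕ :=
  10 * (s n + 2)

/-- Unfolding of `scale` (definitional). [folklore] -/
@[simp] theorem scale_apply (s : ℕ → ℕ) (n : ℕ) : scale s n = 10 * (s n + 2) := rfl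

/-- The description budget fits at the scale: `(s+1)(8(10(s+2)+s)+10) ≤ (10(s+2))²`. [folklore] -/
theorem desc_budget_le_scale_sq (s : ℕ) :
    (s + 1) * (8 * (10 * (s + 2) + s) + 10) ≤ (10 * (s + 2)) ^ 2 := by
  nlinarith

/-- **Thm. 2.3 as consumed by Thm. 3.1**: for a strictly increasing `s` with `n · s(n)² < 2ⁿ` for
all large `n`, the language `diag (scale s)` has circuit complexity `> s(n)` at every large length
(`hdiag` of `AlmostAE.eventually_lt_circuitSize_hardLang_or`). The three side conditions of
`lt_circuitSize_diag` at `N(n) = 10(s(n)+2)`: the budget inequality always holds; `N² + 1 ≤ 2ᴺ`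
for large `N` (and `N(n) ≥ n`); `N(n)² ≤ 400 s(n)² ≤ n s(n)² < 2ⁿ` for `n ≥ 400`.
[cite: MurrayWilliams2018, Thm. 2.3] -/
theorem eventually_lt_circuitSize_diag {s : ℕ → ℕ} (hs : StrictMono s)
    (hsmall : ∀ᶠ n in atTop, n * s n ^ 2 < 2 ^ n) :
    ∀ᶠ n in atTop, s n < (diag (scale s)).circuitSize n := by
  have hsn : ∀ n, n ≤ s n := fun n => hs.id_le n
  obtain ⟨M₀, hM₀⟩ := eventually_atTop.1 (Kannan.eventually_pow_succ_le_two_pow 2)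
  filter_upwards [hsmall, eventually_ge_atTop (max M₀ 400)] with n hn hn'
  have hM : M₀ ≤ n := (le_max_left _ _).trans hn'
  have h400 : 400 ≤ n := (le_max_right _ _).trans hn'
  have hnN : n ≤ scale s n := by rw [scale_apply]; have := hsn n; omega
  refine lt_circuitSize_diag hnN (desc_budget_le_scale_sq (s n)) (hM₀ _ (hM.trans hnN)) ?_
  -- `N(n)² ≤ 400 s(n)² ≤ n s(n)² < 2ⁿ`
  have hs2 : 2 ≤ s n := le_trans (by omega) (hsn n)
  have h1 : (10 * (s n + 2)) ^ 2 ≤ 400 * s n ^ 2 := by nlinarith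
  have h2 : 400 * s n ^ 2 ≤ n * s n ^ 2 := Nat.mul_le_mul_right _ h400
  rw [scale_apply]
  omega

/-! ### Claim 1: the reduction to a `PSPACE`-hard language -/

/-- **Murray–Williams 2018, Claim 1, in `PSPACE`-hardness form.** For every `PSPACE`-hard language
`Lstar` (Karp reductions, `IsHard`) there is ONE polynomial-time `g` (the reduction of Kannan's
`L₀ ∈ PSPACE` to `Lstar`, with a polynomial bound on its output length) such that, at every scale
`N`, `y ∈ diag N ⟺ g (pad (N |y|) y) ∈ Lstar`: the printed reduction `R(y)` is `g` applied to the
padded input, an `Lstar`-instance of length `poly(N(|y|))`.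
[cite: MurrayWilliams2018, §3 (Claim 1)] -/
theorem exists_reduction_of_isHard {Lstar : Language Bool} (h : IsHard PSPACE Lstar) :
    ∃ g : List Bool → List Bool, g ∈ FP ∧ (∃ p : Polynomial ℕ, ∀ w, (g w).length ≤ p.eval w.length) ∧
      ∀ (N : ℕ → ℕ) (y : List Bool), y ∈ diag N ↔ g (pad (N y.length) y) ∈ Lstar := by
  obtain ⟨g, hg, hred⟩ := polyTimeKarpReducible_iff.1 (h _ (Kannan.lang_mem_PSPACE 0))
  exact ⟨g, hg, exists_poly_length_le_of_mem_FP hg, fun N y => hred _⟩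

end KannanScaled

/-! ### Theorem 3.1 and Lemma 4.1 with the scaled Kannan diagonal language -/

/-- **Theorem 3.1 in universal-referee form from a universal protocol for
`hardLang Lstar (KannanScaled.diag (scale s)) s₁ s₂`** — the analogue of
`h31_of_hardLang_protocol` (`MurrayWilliams2018EasyWitnessResidual.lean`) with Murray–Williams'
`L_diag` instantiated by `KannanScaled.diag (KannanScaled.scale s)` instead of the counting table
`GreedyHard.diag s`: the hardness half is `AlmostAE.eventually_lt_circuitSize_hardLang_or` with
`hdiag := KannanScaled.eventually_lt_circuitSize_diag`, the constraints being derived exactly as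
there (`D = max (D₀, A + 1, 2)`, `A` dominating the downward-self-reduction overhead of `Lstar`).
With this `L_diag` the protocol's first branch is a `PSPACE`-query about `pad (N n) y`
(`KannanScaled.exists_reduction_of_isHard`). [cite: MurrayWilliams2018, Thm. 3.1] -/
theorem h31_of_hardLang_protocol_kannanScaled (Lstar : Language Bool)
    (hpad : ∀ z : List Bool, true :: z ∈ Lstar ↔ z ∈ Lstar)
    (hones : ∀ b : ℕ, List.replicate b true ∉ Lstar) (R : AlmostAE.DSR Lstar)
    (hprot : ∃ Ref : Language Bool, Ref ∈ Classes.P ∧ ∃ D₀ : ℕ, 1 ≤ D₀ ∧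
      ∀ (s s₁ s₂ : ℕ → ℕ) (D : ℕ), D₀ ≤ D → StrictMono s → IsTimeConstructible s →
        (∀ᶠ n in atTop, n * s n ^ 2 < 2 ^ n) →
        IsTimeConstructible s₁ → IsTimeConstructible s₂ →
        (∀ᶠ n in atTop, (n + s n + 2) ^ D ≤ s₂ n) → (∀ᶠ n in atTop, s (s₂ n) ^ D ≤ s₁ n) →
        (∀ᶠ n in atTop, (n + s n + 2) ^ D ≤ s₁ n) →
        ∃ adv : ℕ → List Bool, (∀ n, (adv n).length ≤ D₀ * (Nat.log 2 (s₂ n) + 1)) ∧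
          AdvisedMAGame Ref (fun n => (s₁ n * s₂ n) ^ D) adv
            (AlmostAE.hardLang Lstar (KannanScaled.diag (KannanScaled.scale s)) s₁ s₂)) :
    ∃ Ref : Language Bool, Ref ∈ Classes.P ∧ ∃ D : ℕ, 1 ≤ D ∧
      ∀ (s s₁ s₂ : ℕ → ℕ), StrictMono s → IsTimeConstructible s →
        (∀ᶠ n in atTop, n * s n ^ 2 < 2 ^ n) →
        IsTimeConstructible s₁ → IsTimeConstructible s₂ →
        (∀ᶠ n in atTop, (n + s n + 2) ^ D ≤ s₂ n) → (∀ᶠ n in atTop, s (s₂ n) ^ D ≤ s₁ n) →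
        (∀ᶠ n in atTop, (n + s n + 2) ^ D ≤ s₁ n) →
        ∃ (adv : ℕ → List Bool) (L₁ : Language Bool),
          (∀ n, (adv n).length ≤ D * (Nat.log 2 (s₂ n) + 1)) ∧
          AdvisedMAGame Ref (fun n => (s₁ n * s₂ n) ^ D) adv L₁ ∧
          ∀ᶠ n in atTop, s n < L₁.circuitSize n ∨ s (s₂ n) < L₁.circuitSize (s₂ n) := by
  obtain ⟨Ref, hRef, D₀, hD₀, H⟩ := hprot
  obtain ⟨q, hq⟩ := R.exists_circuitSize_succ_le
  obtain ⟨A, hA⟩ := MWSimN.exists_exp_dominating q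
  set D : ℕ := max (max D₀ (A + 1)) 2 with hDdef
  have hD₀D : D₀ ≤ D := (le_max_left _ _).trans (le_max_left _ _)
  have hAD : A + 1 ≤ D := (le_max_right _ _).trans (le_max_left _ _)
  have h2D : 2 ≤ D := le_max_right _ _
  refine ⟨Ref, hRef, D, hD₀.trans hD₀D, fun s s₁ s₂ hs hsc hsmall h₁ h₂ hi hii hiii => ?_⟩
  obtain ⟨adv, hadv, hgame⟩ := H s s₁ s₂ D hD₀D hs hsc hsmall h₁ h₂ hi hii hiii
  refine ⟨adv, AlmostAE.hardLang Lstar (KannanScaled.diag (KannanScaled.scale s)) s₁ s₂,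
    fun n => (hadv n).trans (Nat.mul_le_mul_right _ hD₀D), hgame, ?_⟩
  -- the hardness half of Theorem 3.1 for `hardLang`
  have hsn : ∀ n, n ≤ s n := fun n => hs.id_le n
  have hs₂ : ∀ᶠ n in atTop, n ≤ s₂ n := by
    filter_upwards [hi] with n hn
    exact le_trans (le_trans (by omega) (Nat.le_self_pow (by omega) _)) hn
  -- (ii): `s (s₂ n) + 2 ≤ s (s₂ n) ^ 2 ≤ s (s₂ n) ^ D ≤ s₁ n`
  have hii' : ∀ᶠ n in atTop, s (s₂ n) + 2 ≤ s₁ n := by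
    filter_upwards [hii, hs₂, eventually_ge_atTop 2] with n hn hn₂ h2
    have hx : 2 ≤ s (s₂ n) := h2.trans (hn₂.trans (hsn _))
    have h1 : s (s₂ n) + 2 ≤ s (s₂ n) ^ 2 := by nlinarith
    exact h1.trans ((Nat.pow_le_pow_right (by omega) h2D).trans hn)
  -- (iii): `q (ℓ + s m + 2) ≤ q (m + s m + 2) ≤ (m + s m + 2)^{A+1} ≤ (m + s m + 2)^D ≤ s₁ m`
  have hiii' : ∀ᶠ m in atTop, ∀ ℓ < m, q.eval (ℓ + (s m + 2)) ≤ s₁ m := by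
    filter_upwards [hiii, eventually_ge_atTop (A + A)] with m hm hmA ℓ hℓ
    have hu : A * 1 ^ A + A ≤ m + s m + 2 := by rw [one_pow, mul_one]; omega
    have h1 : q.eval (ℓ + (s m + 2)) ≤ q.eval (1 * (m + s m + 2)) :=
      TM2Iter.eval_mono q (by omega)
    have h2 := hA 1 (m + s m + 2) le_rfl (by omega) hu
    have h3 : (m + s m + 2) ^ (A + 1) ≤ (m + s m + 2) ^ D := Nat.pow_le_pow_right (by omega) hAD
    exact h1.trans (h2.trans (h3.trans hm))
  exact AlmostAE.eventually_lt_circuitSize_hardLang_or (D := fun ℓ S => q.eval (ℓ + S)) hpad hones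
    hs₂ hii' hiii' hq (KannanScaled.eventually_lt_circuitSize_diag hs hsmall)

/-- **Lemma 4.1 (a.e. form) from a universal protocol for the `hardLang` of the scaled Kannan
diagonal language and a generator of Umans' type**: the residual form of the named fact
`MurrayWilliams2018_lemma_4_1_ae` along this file's instantiation of `L_diag` — what remains is
the Merlin–Arthur upper bound (a polynomial-time referee uniform in `s`, for a fixed paddable,
downward self-reducible, checkable `PSPACE`-complete `Lstar`; its first branch a `PSPACE`-query
by `KannanScaled.exists_reduction_of_isHard`) and Umans' generator (`UmansGenerator`).
[cite: MurrayWilliams2018, Lemma 4.1] -/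
theorem MurrayWilliams2018_lemma_4_1_ae_of_hardLang_protocol_kannanScaled_of_umansGenerator
    (Lstar : Language Bool)
    (hpad : ∀ z : List Bool, true :: z ∈ Lstar ↔ z ∈ Lstar)
    (hones : ∀ b : ℕ, List.replicate b true ∉ Lstar) (R : AlmostAE.DSR Lstar)
    (hprot : ∃ Ref : Language Bool, Ref ∈ Classes.P ∧ ∃ D₀ : ℕ, 1 ≤ D₀ ∧
      ∀ (s s₁ s₂ : ℕ → ℕ) (D : ℕ), D₀ ≤ D → StrictMono s → IsTimeConstructible s →
        (∀ᶠ n in atTop, n * s n ^ 2 < 2 ^ n) →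
        IsTimeConstructible s₁ → IsTimeConstructible s₂ →
        (∀ᶠ n in atTop, (n + s n + 2) ^ D ≤ s₂ n) → (∀ᶠ n in atTop, s (s₂ n) ^ D ≤ s₁ n) →
        (∀ᶠ n in atTop, (n + s n + 2) ^ D ≤ s₁ n) →
        ∃ adv : ℕ → List Bool, (∀ n, (adv n).length ≤ D₀ * (Nat.log 2 (s₂ n) + 1)) ∧
          AdvisedMAGame Ref (fun n => (s₁ n * s₂ n) ^ D) adv
            (AlmostAE.hardLang Lstar (KannanScaled.diag (KannanScaled.scale s)) s₁ s₂))
    (G : UmansGenerator) : MurrayWilliams2018_lemma_4_1_ae :=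
  MurrayWilliams2018_lemma_4_1_ae_of_thm_3_1_universal_of_umansGenerator
    (h31_of_hardLang_protocol_kannanScaled Lstar hpad hones R hprot) G

end Literature.Computability.Complexity

end
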